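import Summits.AtomisticToContinuum.Crystallization.Theorems.ThreeConeCertificateExactCertificateSlacknessBlocks
import Summits.AtomisticToContinuum.Crystallization.Theorems.ThreeConeCertificateExactCertificateDilate
import Summits.AtomisticToContinuum.Crystallization.Theorems.ThreeConeCertificateExactCertificateZeroPressure

/-!
# `ExactCertificate` (stmt-AtomisticToContinuum-11959), line `closure-makes-nogap-exact`:
# the stub `stub_tangency` — `C¹` contact of `f` with `V_LJ` on the distance set beyond the range

Support file for the crux `ThreeConeCertificate.ExactCertificate` (line lead, registered stub
`stub_tangency`).  For a three-cone split `IsSplit ρ c g U f` (file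
`ExactCertificate/Negative/SplitBasics`) whose value attains a periodic configuration `P`,
`c + f 0 / 2 ≤ −e(P)`, and a distance `r = dist p q` of `P` with `r > ρ`, we prove:

* `U_dilate_le` : the slack at every DILATED distance is paid by the dilation excess of the
  template, `U (t·r) ≤ 4·#F·(e_{LJ(t·)}(P) − e_LJ(P))` for all `t > 0` — pair counting in the
  blocks of the dilate `t • P` (`Dilation.stub_dilate`, `Slackness.sub_mul_le_two_mul_energy`)
  against the `U`-slack of those blocks relative to `P` (blocks are trial states,
  `Blocks.exists_block_energy_le`);
* `le_energyPerParticle_dilate` : a witness template gains no energy under dilation, so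
  `Dilation.stub_zeroPressure` applies: `e_{LJ(t·)}(P) − e_LJ(P) = (e₆(P)/12)·(t⁻⁶ − 1)²`;
* `U_le_mul_sq`, `lennardJones_sub_squeeze` : hence the QUADRATIC SQUEEZE
  `0 ≤ V_LJ(s) − f(s) = U(s) ≤ C·(s − r)²` for `|s − r| < min (r/2) (r − ρ)`;
* `hasDerivAt_of_sq_squeeze` : a function squeezed quadratically under a differentiable one
  shares its derivative; with `hasDerivAt_lennardJones_deriv` this gives
* **`stub_tangency`** (signature verbatim): the squeeze and `HasDerivAt f (V_LJ'(r)) r`.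

All `[folklore]`.  Not here: anything at distances `≤ ρ`, second-order contact, or the open stubs
`stub_noGap` / `stub_periodicMinimum` of the line.
-/

noncomputable section

namespace Summit.AtomisticToContinuum.Crystallization.Theorems.ThreeConeCertificateExactCertificate.Contact

open Literature.MathematicalPhysics.StatisticalMechanics
open Summit.AtomisticToContinuum.Crystallization.Theorems.ChargedEnergyGapNegative
  (E3 eStar eStar_le)
open Summit.AtomisticToContinuum.Crystallization.Theorems.ChargedEnergyGapNegative.Blocks
  (BIdx blockConfig blockConfig_injective card_BIdx exists_block_energy_le)
open Summit.AtomisticToContinuum.Crystallization.Theorems.ExactCertificateNegative (IsSplit)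
open Summit.AtomisticToContinuum.Crystallization.Theorems.ThreeConeCertificateExactCertificate.Slackness
  (witness_eq sub_mul_le_two_mul_energy)
open Summit.AtomisticToContinuum.Crystallization.Theorems.ThreeConeCertificateExactCertificate.Dilation
  (stub_dilate stub_zeroPressure)
open scoped BigOperators Topology
open Filter Asymptotics

/-! ## The slack at dilated distances -/

/-- **A witness template gains no energy under dilation of the potential**: for `t > 0`,
`e_LJ(P) ≤ e_{LJ(t·)}(P)`, because `e_{LJ(t·)}(P) = e_LJ(t • P) ≥ e* = e_LJ(P)`
(`Dilation.stub_dilate`, `eStar_le`, `Slackness.witness_eq`). [folklore] -/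
theorem le_energyPerParticle_dilate {P : PeriodicConfiguration 3} {ρ c : ℝ} {g U f : ℝ → ℝ}
    (h : IsSplit ρ c g U f) (hv : c + f 0 / 2 ≤ -(P.energyPerParticle lennardJones)) {t : ℝ}
    (ht : 0 < t) :
    P.energyPerParticle lennardJones ≤ P.energyPerParticle (fun r => lennardJones (t * r)) := by
  obtain ⟨Q, -, -, hQe⟩ := stub_dilate P t ht
  rw [← hQe, (witness_eq h hv).1]
  exact eStar_le Q

/-- The per-particle lattice sum `e₆(P) = e_{r⁻⁶}(P)` is non-negative (termwise). [folklore] -/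
theorem energyPerParticle_inv_pow_six_nonneg (P : PeriodicConfiguration 3) :
    0 ≤ P.energyPerParticle (fun r => (r⁻¹) ^ 6) := by
  unfold PeriodicConfiguration.energyPerParticle
  refine mul_nonneg (by positivity) (Finset.sum_nonneg fun x _ => tsum_nonneg fun y => ?_)
  positivity

/-- **The slack at dilated distances is paid by the dilation excess**: for a witness, a distance
`r = dist p q` of `P` and every `t > 0`, `U (t·r) ≤ 4·#F·(e_{LJ(t·)}(P) − e_LJ(P))`.  Pair counting
in the `K`-blocks of the dilate `t • P` (the distance `t·r` is realised `≥ K³ − 6MK²` times,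
`Slackness.sub_mul_le_two_mul_energy`) against the `U`-slack of those blocks relative to `P`:
`E_U = E_LJ − E_g − E_f ≤ E_LJ + (c + f 0/2)·N = E_LJ − N·e(P) ≤ N·(e_LJ(t • P) + ε − e(P))`
(stability of `g`, the Bochner bound for `f`, `Slackness.witness_eq`, blocks are trial states
`Blocks.exists_block_energy_le`), and `e_LJ(t • P) = e_{LJ(t·)}(P)` (`Dilation.stub_dilate`).
[folklore] -/
theorem U_dilate_le {P : PeriodicConfiguration 3} {ρ c : ℝ} {g U f : ℝ → ℝ} (h : IsSplit ρ c g U f)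
    (hv : c + f 0 / 2 ≤ -(P.energyPerParticle lennardJones)) {p q : E3} (hp : p ∈ P.points)
    (hq : q ∈ P.points) (hpq : p ≠ q) {t : ℝ} (ht : 0 < t) :
    U (t * dist p q) ≤ 4 * P.motif.card *
      (P.energyPerParticle (fun r => lennardJones (t * r)) - P.energyPerParticle lennardJones) := by
  obtain ⟨Q, hQF, hQpts, hQe⟩ := stub_dilate P t ht
  have hp' : t • p ∈ Q.points := by rw [hQpts]; exact Set.mem_image_of_mem _ hp
  have hq' : t • q ∈ Q.points := by rw [hQpts]; exact Set.mem_image_of_mem _ hq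
  have hpq' : t • p ≠ t • q := fun heq => hpq (smul_right_injective E3 ht.ne' heq)
  have hdist : dist (t • p) (t • q) = t * dist p q := by
    rw [dist_smul₀, Real.norm_eq_abs, abs_of_pos ht]
  have hU0 : 0 ≤ U (t * dist p q) := h.U_nonneg _ (mul_pos ht (dist_pos.2 hpq))
  set D : ℝ := P.energyPerParticle (fun r => lennardJones (t * r)) -
    P.energyPerParticle lennardJones with hDdef
  refine le_of_forall_pos_le_add fun ε hε => ?_
  obtain ⟨M, hM⟩ := sub_mul_le_two_mul_energy Q h.U_nonneg hp' hq' hpq'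
  set F : ℝ := (P.motif.card : ℝ) with hFdef
  have hF : 0 < F := by rw [hFdef]; exact_mod_cast P.motif_nonempty.card_pos
  obtain ⟨K₀, -, hK⟩ := exists_block_energy_le Q (show 0 < ε / (4 * F) by positivity)
  set K : ℕ := max K₀ (12 * M + 12) with hKdef
  have h1 := hM K
  rw [hdist] at h1
  have h2 := hK K (le_max_left _ _)
  have hcard : ((Fintype.card (BIdx Q K) : ℕ) : ℝ) = F * (K : ℝ) ^ 3 := by
    rw [card_BIdx, hQF]; push_cast; rw [hFdef]
  have hinj := blockConfig_injective Q K
  have h3 := h.energy_eq hinj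
  have h4 := h.stable _ _ hinj
  have h5 := h.f_energy_ge (blockConfig Q K)
  obtain ⟨hw1, hw2⟩ := witness_eq h hv
  rw [hcard] at h2 h4 h5
  rw [hQe] at h2
  -- the `U`-slack of the block of the dilate, relative to `P`
  have hEU : interactionEnergy U (blockConfig Q K) ≤
      F * (K : ℝ) ^ 3 * D + ε * (K : ℝ) ^ 3 / 4 := by
    have hF0 : F ≠ 0 := hF.ne'
    have e0 : F * (K : ℝ) ^ 3 * (ε / (4 * F)) = ε * (K : ℝ) ^ 3 / 4 := by
      field_simp
    have e1 : F * (K : ℝ) ^ 3 * (P.energyPerParticle (fun r => lennardJones (t * r)) + ε / (4 * F)) =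
        F * (K : ℝ) ^ 3 * D + F * (K : ℝ) ^ 3 * eStar + ε * (K : ℝ) ^ 3 / 4 := by
      rw [mul_add, e0, hDdef, hw1]; ring
    have e2 : F * (K : ℝ) ^ 3 * eStar = -(c * (F * (K : ℝ) ^ 3)) - F * (K : ℝ) ^ 3 * f 0 / 2 := by
      rw [show eStar = -(c + f 0 / 2) by linarith]; ring
    linarith
  -- `K` is large: `K³/2 ≤ K³ − 6MK²`
  have hK12 : (12 * M + 12 : ℝ) ≤ K := by
    have : 12 * M + 12 ≤ K := le_max_right _ _
    exact_mod_cast this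
  have hM0 : (0 : ℝ) ≤ M := Nat.cast_nonneg M
  have hKpos : (0 : ℝ) < K := by linarith
  have hhalf : (K : ℝ) ^ 3 / 2 ≤ (K : ℝ) ^ 3 - 6 * M * (K : ℝ) ^ 2 := by
    have e1 : (K : ℝ) ^ 3 - 6 * M * (K : ℝ) ^ 2 - (K : ℝ) ^ 3 / 2 =
        (K : ℝ) ^ 2 * ((K : ℝ) / 2 - 6 * M) := by ring
    have e2 : (0 : ℝ) ≤ (K : ℝ) ^ 2 * ((K : ℝ) / 2 - 6 * M) :=
      mul_nonneg (sq_nonneg _) (by linarith)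
    linarith
  have h6 : (K : ℝ) ^ 3 / 2 * U (t * dist p q) ≤ 2 * interactionEnergy U (blockConfig Q K) :=
    (mul_le_mul_of_nonneg_right hhalf hU0).trans h1
  have h7 : (K : ℝ) ^ 3 / 2 * U (t * dist p q) ≤ (K : ℝ) ^ 3 / 2 * (4 * F * D + ε) := by
    have e3 : (K : ℝ) ^ 3 / 2 * (4 * F * D + ε) =
        2 * (F * (K : ℝ) ^ 3 * D + ε * (K : ℝ) ^ 3 / 4) := by ring
    rw [e3]
    linarith
  exact le_of_mul_le_mul_left h7 (by positivity)

/-! ## The quadratic squeeze -/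

/-- Elementary calculus: for `0 < r` and `r/2 < s`, `((r/s)⁶ − 1)² ≤ (15876/r²)·(s − r)²`
(`u⁶ − 1 = (u − 1)(u⁵ + ⋯ + 1)` with `u = r/s ∈ (0, 2)`, `|u − 1| = |s − r|/s ≤ 2|s − r|/r`).
[folklore] -/
theorem sq_inv_div_pow_six_sub_one_le {r s : ℝ} (hr : 0 < r) (hs : r / 2 < s) :
    ((s / r)⁻¹ ^ 6 - 1) ^ 2 ≤ 15876 / r ^ 2 * (s - r) ^ 2 := by
  have hs0 : 0 < s := by linarith
  rw [inv_div]
  have hu0 : 0 < r / s := by positivity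
  have hu2 : r / s ≤ 2 := by rw [div_le_iff₀ hs0]; linarith
  have hu1 : r / s - 1 = (r - s) / s := by field_simp
  have hfac : ((r / s) ^ 6 - 1) ^ 2 = ((r - s) / s) ^ 2 *
      ((r / s) ^ 5 + (r / s) ^ 4 + (r / s) ^ 3 + (r / s) ^ 2 + r / s + 1) ^ 2 := by
    rw [← hu1]; ring
  have hgeom : ((r / s) ^ 5 + (r / s) ^ 4 + (r / s) ^ 3 + (r / s) ^ 2 + r / s + 1) ^ 2 ≤ 63 ^ 2 := by
    have h5 := pow_le_pow_left₀ hu0.le hu2 5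
    have h4 := pow_le_pow_left₀ hu0.le hu2 4
    have h3 := pow_le_pow_left₀ hu0.le hu2 3
    have h2 := pow_le_pow_left₀ hu0.le hu2 2
    have hle : (r / s) ^ 5 + (r / s) ^ 4 + (r / s) ^ 3 + (r / s) ^ 2 + r / s + 1 ≤ 63 := by
      norm_num at h5 h4 h3 h2
      linarith
    exact pow_le_pow_left₀ (by positivity) hle 2
  have hsq : ((r - s) / s) ^ 2 ≤ 4 / r ^ 2 * (s - r) ^ 2 := by
    rw [div_pow, div_le_iff₀ (by positivity)]
    have e1 : (r - s) ^ 2 = (s - r) ^ 2 := by ring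
    have e2 : 4 / r ^ 2 * (s - r) ^ 2 * s ^ 2 = (s - r) ^ 2 * ((2 * s) ^ 2 / r ^ 2) := by ring
    rw [e1, e2]
    have h4 : 1 ≤ (2 * s) ^ 2 / r ^ 2 := by
      rw [one_le_div (by positivity)]
      exact pow_le_pow_left₀ hr.le (by linarith) 2
    exact le_mul_of_one_le_right (sq_nonneg _) h4
  rw [hfac]
  calc ((r - s) / s) ^ 2 *
        ((r / s) ^ 5 + (r / s) ^ 4 + (r / s) ^ 3 + (r / s) ^ 2 + r / s + 1) ^ 2
      ≤ 4 / r ^ 2 * (s - r) ^ 2 * 63 ^ 2 :=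
        mul_le_mul hsq hgeom (by positivity) (by positivity)
    _ = 15876 / r ^ 2 * (s - r) ^ 2 := by ring

/-- **The slack is quadratically small near a distance of the template**: for a witness, a
distance `r = dist p q` of `P` and `s > r/2`,
`U(s) ≤ #F · e₆(P) · (5292/r²) · (s − r)²` — `U_dilate_le` at `t = s/r` with the explicit
dilation excess `(e₆(P)/12)·((r/s)⁶ − 1)²` of `Dilation.stub_zeroPressure`. [folklore] -/
theorem U_le_mul_sq {P : PeriodicConfiguration 3} {ρ c : ℝ} {g U f : ℝ → ℝ} (h : IsSplit ρ c g U f)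
    (hv : c + f 0 / 2 ≤ -(P.energyPerParticle lennardJones)) {p q : E3} (hp : p ∈ P.points)
    (hq : q ∈ P.points) (hpq : p ≠ q) {s : ℝ} (hs : dist p q / 2 < s) :
    U s ≤ P.motif.card * P.energyPerParticle (fun r => (r⁻¹) ^ 6) * (5292 / dist p q ^ 2) *
      (s - dist p q) ^ 2 := by
  have hr0 : 0 < dist p q := dist_pos.2 hpq
  have hs0 : 0 < s := by linarith
  have ht : 0 < s / dist p q := by positivity
  have h1 := U_dilate_le h hv hp hq hpq ht
  rw [div_mul_cancel₀ s hr0.ne',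
    (stub_zeroPressure P fun t ht => le_energyPerParticle_dilate h hv ht).2.2 _ ht] at h1
  have h2 := sq_inv_div_pow_six_sub_one_le hr0 hs
  have he6 := energyPerParticle_inv_pow_six_nonneg P
  calc U s ≤ _ := h1
    _ ≤ 4 * P.motif.card * (1 / 12 * P.energyPerParticle (fun r => (r⁻¹) ^ 6) *
          (15876 / dist p q ^ 2 * (s - dist p q) ^ 2)) :=
        mul_le_mul_of_nonneg_left (mul_le_mul_of_nonneg_left h2 (mul_nonneg (by norm_num) he6))
          (by positivity)
    _ = _ := by ring

/-- **The quadratic squeeze** (first half of the stub): for a witness and a distance `r = dist p q`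
of `P` with `r > ρ`, with `δ = min (r/2) (r − ρ)`: for `|s − r| < δ` one has `s > ρ`, `s > 0`, so
`V_LJ(s) − f(s) = U(s)` (`IsSplit.f_eq_tail`), which is `≥ 0` and `≤ C·(s − r)²` (`U_le_mul_sq`).
[folklore] -/
theorem lennardJones_sub_squeeze {P : PeriodicConfiguration 3} {ρ c : ℝ} {g U f : ℝ → ℝ}
    (h : IsSplit ρ c g U f) (hv : c + f 0 / 2 ≤ -(P.energyPerParticle lennardJones)) {p q : E3}
    (hp : p ∈ P.points) (hq : q ∈ P.points) (hpq : p ≠ q) (hρ : ρ < dist p q) :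
    ∃ C δ : ℝ, 0 < δ ∧ ∀ s : ℝ, |s - dist p q| < δ →
      0 ≤ lennardJones s - f s ∧ lennardJones s - f s ≤ C * (s - dist p q) ^ 2 := by
  have hr0 : 0 < dist p q := dist_pos.2 hpq
  refine ⟨P.motif.card * P.energyPerParticle (fun r => (r⁻¹) ^ 6) * (5292 / dist p q ^ 2),
    min (dist p q / 2) (dist p q - ρ), lt_min (by linarith) (by linarith), fun s hs => ?_⟩
  have hlt := (abs_lt.1 hs).1
  have hm1 := min_le_left (dist p q / 2) (dist p q - ρ)
  have hm2 := min_le_right (dist p q / 2) (dist p q - ρ)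
  have hs1 : dist p q / 2 < s := by linarith
  have hs2 : ρ ≤ s := by linarith
  have hs0 : 0 < s := by linarith
  have hw : lennardJones s - f s = U s := by rw [h.f_eq_tail hs2 hs0]; ring
  rw [hw]
  exact ⟨h.U_nonneg s hs0, U_le_mul_sq h hv hp hq hpq hs1⟩

/-! ## Derivatives -/

/-- `V_LJ(r) = (1/12) r⁻¹² − (1/6) r⁻⁶` is differentiable at every `r ≠ 0` (chain rule from
`hasDerivAt_inv`), stated with its `deriv`. [folklore] -/
theorem hasDerivAt_lennardJones_deriv {r : ℝ} (hr : r ≠ 0) :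
    HasDerivAt lennardJones (deriv lennardJones r) r := by
  have hinv : HasDerivAt (fun y : ℝ => y⁻¹) (-(r ^ 2)⁻¹) r := hasDerivAt_inv hr
  have hfun : lennardJones = fun y : ℝ => (1 / 12 : ℝ) * (y⁻¹) ^ 12 - (1 / 6 : ℝ) * (y⁻¹) ^ 6 := by
    funext y; simp [lennardJones]
  have hder := ((hinv.fun_pow 12).const_mul (1 / 12 : ℝ)).fun_sub
    ((hinv.fun_pow 6).const_mul (1 / 6 : ℝ))
  rw [hfun]
  exact hder.differentiableAt.hasDerivAt

/-- **Squeeze for derivatives**: if `V` is differentiable at `r` and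
`0 ≤ V(s) − f(s) ≤ C·(s − r)²` for `|s − r| < δ` (`δ > 0`), then `f` is differentiable at `r` with
`f'(r) = V'(r)`: `w = V − f` vanishes at `r` and is `O((s − r)²) = o(s − r)`, so `w'(r) = 0`, and
`f = V − w`. [folklore] -/
theorem hasDerivAt_of_sq_squeeze {V f : ℝ → ℝ} {r v C δ : ℝ} (hV : HasDerivAt V v r) (hδ : 0 < δ)
    (hsq : ∀ s : ℝ, |s - r| < δ → 0 ≤ V s - f s ∧ V s - f s ≤ C * (s - r) ^ 2) :
    HasDerivAt f v r := by
  have h0 : V r - f r = 0 := by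
    obtain ⟨h1, h2⟩ := hsq r (by simpa using hδ)
    have : C * (r - r) ^ 2 = 0 := by ring
    linarith
  have hO : (fun s => V s - f s) =O[𝓝 r] fun s => ‖s - r‖ ^ 2 := by
    refine IsBigO.of_bound C ?_
    rw [Metric.eventually_nhds_iff]
    refine ⟨δ, hδ, fun s hs => ?_⟩
    rw [Real.dist_eq] at hs
    obtain ⟨h1, h2⟩ := hsq s hs
    simp only [norm_pow, Real.norm_eq_abs, sq_abs, abs_of_nonneg h1]
    exact h2
  have hw : HasDerivAt (fun s => V s - f s) 0 r := by
    refine HasDerivAt.of_isLittleO ?_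
    simp only [smul_zero, sub_zero, h0]
    exact hO.trans_isLittleO (isLittleO_pow_sub_sub r one_lt_two)
  have hf := hV.fun_sub hw
  simp only [sub_sub_cancel, sub_zero] at hf
  exact hf

/-! ## The registered stub -/

/-- **Registered stub `stub_tangency` of the line `closure-makes-nogap-exact`** (signature
verbatim): for a witness split attaining a periodic `P` and a distance `r = dist p q` of `P` with
`r > ρ`, the slack `V_LJ − f` is squeezed quadratically near `r`
(`lennardJones_sub_squeeze`), and consequently `f` is differentiable at `r` with
`f'(r) = V_LJ'(r)` (`hasDerivAt_of_sq_squeeze`, `hasDerivAt_lennardJones_deriv`). [folklore] -/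
theorem stub_tangency : ∀ (P : PeriodicConfiguration 3) (ρ c : ℝ) (g U f : ℝ → ℝ),
    IsSplit ρ c g U f → c + f 0 / 2 ≤ -(P.energyPerParticle lennardJones) →
    ∀ p ∈ P.points, ∀ q ∈ P.points, p ≠ q → ρ < dist p q →
      (∃ C δ : ℝ, 0 < δ ∧ ∀ s : ℝ, |s - dist p q| < δ →
        0 ≤ lennardJones s - f s ∧ lennardJones s - f s ≤ C * (s - dist p q) ^ 2) ∧
      HasDerivAt f (deriv lennardJones (dist p q)) (dist p q) := by
  intro P ρ c g U f h hv p hp q hq hpq hρ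
  obtain ⟨C, δ, hδ, hC⟩ := lennardJones_sub_squeeze h hv hp hq hpq hρ
  exact ⟨⟨C, δ, hδ, hC⟩,
    hasDerivAt_of_sq_squeeze (hasDerivAt_lennardJones_deriv (dist_pos.2 hpq).ne') hδ hC⟩

end Summit.AtomisticToContinuum.Crystallization.Theorems.ThreeConeCertificateExactCertificate.Contact

end
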